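import Literature.Geometry.Lorentzian.KerrDerivativeDecay
import Literature.Geometry.Lorentzian.KerrSliceBall
import Literature.Analysis.FunctionSpaces.SobolevDomainNormProofs
import HarnessLib

/-!
# DRSR Corollary 3.1 (31) in coordinate form from the higher-order local energy decay:
# the Sobolev step on the slice portions `{r₊ < r} ∩ {‖y‖ < R}`, proved

(statement group **gr.S24**; namespace `Literature.Geometry.Lorentzian.Kerr`, the Sobolev-norm
bookkeeping and the glue in `Literature.Geometry.Lorentzian`)

`KerrWaveDecay.lean` vendors the pointwise derivative estimate (31) of Dafermos–Rodnianski–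
Shlapentokh-Rothman (*Decay for solutions of the wave equation on Kerr exterior spacetimes III*,
arXiv:1402.7034 = Ann. of Math. 183 (2016), "DRSR", §3.3, Cor. 3.1) in local coordinate form as
the named fact `Literature.Geometry.Lorentzian.drsr_wave_derivative_decay_kerr`
(`∑_μ (∂_μψ)²(τ, y) ≤ C τ^{-4+2δ}`, `τ ≥ 1`, at the points of the Kerr–Schild slices `{t*_KS = τ}`
with `r > r₊`, `‖y‖ ≤ R`, for admissible waves). `KerrDerivativeDecay.lean` reduced it to the
printed (31) read through the hyperboloidal leaves `Σ̃_τ(h♯_{R₁})` and recorded the two layers of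
the printed proof below (31) (its module docstring, *The printed proof of (31) and the next
layer*): **(E)** the `τ^{-4+2δ}` decay of the non-degenerate *higher-order local energies* through
the leaves (DRSR Cor. 3.1, second estimate, for the commuted fields, with the elliptic estimate
(29) of Thm. 3.2; in the detailed treatment Moschidis, arXiv:1509.08489, Thm. 9.1), and **(S)** the
Sobolev inequality `H² ↪ L^∞` on the leaf portions `Σ̃_τ ∩ {r ≤ R}` ("uniform pointwise bounds on
`|ψ|` and its derivatives … follow … in view of the Sobolev inequality applied on each `Σ_τ`",
DRSR p. 14; arXiv:0910.4957, §5), noting that neither was available. Since then the tree has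
acquired Sobolev's imbedding `W^{2,2}(Ω) → C_B(Ω)` on bounded Lipschitz domains of `ℝ³`
(`Literature.Analysis.FunctionSpaces.exists_forall_enorm_le_eSobolevDomainNorm_two`,
`SobolevSupBoundDomain.lean`; Adams 1975, Thm. 5.4), and the companion `KerrSliceBall.lean` shows
that it applies to the slice portions: the exterior slice `S = {y ∈ E3 | r(0, y) > r₊}` is the
exterior `{q > 1}` of the closed solid horizon ellipsoid (`Kerr.mem_slice_rPlus_iff`), the **slice
balls** `Kerr.sliceBall M a R = S ⊓ B(0, R)` are bounded Lipschitz domains for `R > 2M`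
(`Kerr.isLipschitzDomain_sliceBall`), and `‖f(y)‖ ≤ K ‖f‖_{W^{2,2}(sliceBall)}` there
(`Kerr.exists_enorm_le_eSobolevDomainNorm_sliceBall`). This file **proves layer (S)** for the
Kerr–Schild slices and the assembly, so that the coordinate derivative-decay fact rests on the
energy-level statement (E) alone:

* `localH2Energy Ω f = ∫_Ω (f² + ‖Df‖² + ‖D²f‖²)` and
  `exists_eSobolevDomainNorm_two_le_localH2Energy` (**proved**): for `f` smooth on an open
  `Ω ⊆ E3`, `‖f‖_{W^{2,2}(Ω)} ≤ C (localH2Energy Ω f)^{1/2}` (the tree's sum-form norm through weak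
  derivatives, bounded by its value at the classical ones);
* `Kerr.sliceGradComp M a ψ τ μ = (y ↦ ∂_μ ψ̃(τ, y))` (so that `∑_μ G_μ² = coordEnergyDensity`,
  `Kerr.coordEnergyDensity_ofTimeSpace`, by `rfl`), smooth on `S` for smooth `ψ`, and
  `Kerr.localGradSobolevEnergy M a ψ τ R = ∑_μ localH2Energy (S ∩ B(0, R)) G_μ` — the quantity of
  hypothesis (E): all coordinate derivatives `∂_y^β ∂_μ ψ`, `|β| ≤ 2`, square-integrated over the
  slice portion `{t* = τ} ∩ {r > r₊} ∩ {‖y‖ < R}`;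
* `drsr_wave_derivative_decay_kerr_of_localGradSobolevEnergy_decay` (**proved**): hypothesis
  (E) — `localGradSobolevEnergy M a ψ τ R ≤ C(ψ, δ, R) τ^{-4+2δ}` for `τ ≥ 1`, every admissible `ψ`,
  `δ > 0`, `R` — implies `drsr_wave_derivative_decay_kerr`: at a slice point `(τ, y)` with
  `‖y‖ ≤ R`, `G_μ(y)² ≤ (K C)² · 𝓔(τ, R') ≤ (K C)² C' τ^{-4+2δ}` on the slice ball of radius
  `R' = max(R, 2M) + 1`, and the four components are summed; with the corollaries
  `drsr_wave_polynomial_decay_kerr_of_localGradSobolevEnergy_decay`,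
  `drsr_wave_local_energy_decay_kerr_of_localGradSobolevEnergy_decay` through `KerrWaveDecay.lean`,
  and the monotonicity of both energies in the region (`localH2Energy_mono`,
  `Kerr.localGradSobolevEnergy_mono`).

**Why (E) is a hypothesis and not a named fact (D-0026).** This file is written from the proving
seat of `drsr_wave_derivative_decay_kerr`, which may not add unproved named facts; the deep input
is an explicit binder of the assembly theorem (as hypotheses (D), (GN) of
`KerrPointwiseDecayHierarchy.lean` and `h31` of `KerrDerivativeDecay.lean`), with its derivation
from the printed sources recorded in the docstring of the theorem. Unlike the reduction of
`KerrDerivativeDecay.lean` (hypothesis = the printed pointwise estimate (31) itself) and the (30)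
hierarchy (where the interpolation inequality (GN) stays a hypothesis), here the classical layer is
proved and the remaining hypothesis is a square-integrated *energy* statement — the currency of
DRSR Thm. 3.2 / Cor. 3.1 (second estimate) and of Moschidis Thm. 9.1 (`q = 2`, `m = 1`, `d = 3`),
which a literature seat for arXiv:1509.08489 may vendor (for the foliation `Σ̃_τ(h♯_{R₁})` and the
data class `Kerr.HasBallData`, on whose leaves the slice balls `{‖y‖ < R ≤ R₁}` lie) and feed in by
`exact drsr_wave_derivative_decay_kerr_of_localGradSobolevEnergy_decay hE`.

## Design choices

* **Slice balls, not leaves.** (31) is a supremum over `Σ̃_τ ∩ {r ≤ R}`; for the foliation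
  `Σ̃_τ(h♯_{R₁})` of `KerrHyperboloidalFlux.lean` and `R ≤ R₁` this portion *is* the portion of the
  Kerr–Schild slice `{t*_KS = τ}` (`Kerr.scriHeight_eq_zero_of_radius_le`), parametrised by
  `y ∈ S`; coordinate balls `{‖y‖ < R}` and radius balls `{r < R}` are cofinal (`r ≤ ‖y‖ ≤ √(r² +
  a²)`), so hypothesis and conclusion are stated on `S ∩ B(0, R)` directly, for admissible waves,
  with no reference to the foliation (every admissible wave has ball data for `R₁` large,
  `KerrDerivativeDecay.lean`).
* **Up to the horizon.** The supremum in `drsr_wave_derivative_decay_kerr` runs over points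
  arbitrarily close to `𝓗⁺ ∩ {t* = τ} = {q = 1}`, where the extension by zero `ψ̃` is not smooth; a
  uniform constant therefore needs Sobolev's inequality on the non-convex domain `S ∩ B(0, R')`
  itself (cone condition up to the inner boundary), not on small balls — hence the Lipschitz-domain
  geometry of `KerrSliceBall.lean` (DRSR: `ψ` is smooth on the manifold with boundary
  `D⁺(Σ̃₀) ∋ 𝓗⁺`, and the Sobolev inequality is applied on the compact `Σ̃_τ ∩ {r ≤ R}`).
* **Which derivatives.** `W^{2,2}` control of the four gradient components needs exactly the
  slice-tangential derivatives of order `≤ 2` of `∂_μ ψ`: orders one to three in `ψ` with at most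
  one transversal index, the structure of the right-hand side of (29),
  `∑_{1≤i≤j} ‖ψ‖²_{H̊ⁱ(Σ_τ)} + ‖n_Σ ψ‖²_{H̊^{i-1}(Σ_τ)}` with `j = 3` (`∂_{t*} = (lapse) n_Σ + shift`);
  no use of the wave equation is hidden in (E).
* **Norms and constants.** `‖Df‖`, `‖D²f‖` are operator norms (`fderiv`, `fderiv ∘ fderiv`), as in
  `KerrPointwiseDecayHierarchy.lean`; the tree's `eSobolevDomainNorm` is the sum-form norm over the
  basis `Module.finBasis ℝ E3`, whence the basis-dependent (finite, existential) constant of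
  `exists_eSobolevDomainNorm_two_le_localH2Energy`. All constants are absorbed existentially, as in
  the vendored fact.
* Binders use `Kerr.region a (Kerr.rPlus M a)` for `Kerr.exterior M a` and
  `(Kerr.slice a (Kerr.rPlus M a) : Set E3)` for `S` (definitional conventions of
  `KerrHyperboloidalFlux.lean`, `KerrPointwiseDecayHierarchy.lean`). Imports: `KerrDerivativeDecay`
  (the fact, `Kerr.contDiffAt_extend`, `contDiffAt_fderiv_apply_const_infty` and the Kerr–Schild
  bookkeeping), `KerrSliceBall` (slice balls and Sobolev's inequality on them; it re-exports
  `KerrHyperboloidalLeaves` for `E4.contDiff_ofTimeSpace`), `SobolevDomainNormProofs`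
  (`eSobolevDomainNorm_lt_top_iff_holds`).

## Mathlib / tree search

Mathlib (this pin) has no Sobolev spaces on domains; everything Sobolev is the tree's
(`MemSobolevDomain`, `eSobolevDomainNorm`, `MeyersSerrin.hasWeakFDerivOn_of_contDiffOn`,
`SobolevApprox.eSobolevDomainNorm_succ_le`, `eSobolevDomainNorm_lt_top_iff_holds`,
`exists_forall_enorm_le_eSobolevDomainNorm_two`). `lean search` finds no prior `localH2Energy`-type
quantity on `E3` (the leaf energies `Kerr.leafGradEnergy`/`Kerr.leafHessEnergy` of
`KerrPointwiseDecayHierarchy.lean` are whole-slice integrals of `ψ` itself, first and second order)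
and no `sliceGradComp` (`timeDeriv` of `KerrTimeDerivative.lean` is the `μ = 0` component as a
function on the chart).

## References

* M. Dafermos, I. Rodnianski, Y. Shlapentokh-Rothman, *Decay for solutions of the wave equation
  on Kerr exterior spacetimes III: the full subextremal case `|a| < M`*, Ann. of Math. 183 (2016)
  787–913, arXiv:1402.7034: §3.2 Thm. 3.2 (28)–(29), p. 14 (pointwise bounds by the Sobolev
  inequality on each `Σ_τ`), §3.3 Cor. 3.1 (second estimate; (31))
  (key `DafermosRodnianskiShlapentokhrothman2014`).
* G. Moschidis, *The `r^p`-weighted energy method of Dafermos and Rodnianski in general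
  asymptotically flat spacetimes and applications*, Ann. PDE 2 (2016), arXiv:1509.08489: §1.3.3,
  §9.2 (the energies `𝓔_en^{(p,q,m)}`, `𝓔_bound^{(p,q,m)}`), Thm. 9.1, Cor. 9.2 (key `Moschidis2016`).
* M. Dafermos, I. Rodnianski, *A new physical-space approach to decay for the wave equation with
  applications to black hole spacetimes*, XVIth ICMP (2010), arXiv:0910.4957, §5
  (key `DafermosRodnianski2010ICMP`).
* R. A. Adams, *Sobolev Spaces* (1975), Thm. 5.4 Part I Case C (8), ¶3.1 (key `Adams1975`).
* B. O'Neill, *The geometry of Kerr black holes* (1995), Ch. 2, §2.1 (key `ONeill1995`);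
  M. Visser, arXiv:0706.0622, (35).
* P. Grisvard, *Elliptic problems in nonsmooth domains* (1985), §1.2.1 (key `Grisvard1985`).
-/

noncomputable section

open Set Filter TopologicalSpace MeasureTheory Metric
open scoped Topology ENNReal Manifold ContDiff

namespace Literature.Geometry.Lorentzian

/-! ### Sobolev norms of functions smooth on an open set of `E3`: a classical bound -/

section SobolevBound

open Literature.Analysis.FunctionSpaces

/-- The **local `H²` energy** of a real function `f` over a set `Ω ⊆ E3`:
`∫_Ω (f² + ‖Df‖² + ‖D²f‖²) dy ∈ [0, ∞]`, with the operator norms of the classical first and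
second Fréchet derivatives (Adams, *Sobolev Spaces* (1975), ¶3.1: the `W^{2,2}(Ω)` norm of a
function smooth on `Ω`, up to the choice of an equivalent finite-dimensional norm on `D f`,
`D² f`). [folklore] -/
def localH2Energy (Ω : Set E3) (f : E3 → ℝ) : ℝ≥0∞ :=
  ∫⁻ y in Ω, ENNReal.ofReal (f y ^ 2 + ‖fderiv ℝ f y‖ ^ 2 + ‖fderiv ℝ (fderiv ℝ f) y‖ ^ 2)

/-- The local `H²` energy is monotone in the region of integration. [folklore] -/
theorem localH2Energy_mono {Ω Ω' : Set E3} (h : Ω ⊆ Ω') (f : E3 → ℝ) :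
    localH2Energy Ω f ≤ localH2Energy Ω' f :=
  lintegral_mono_set h

/-- The derivative of a partial derivative is the second derivative:
`∂_w (z ↦ Df(z) v) (y) = D²f(y)(w)(v)` for `f` of class `C²` at `y` (the `E3` copy of
`fderiv_fderiv_apply_eq` of `KerrTimeDerivative.lean`). [folklore] -/
theorem fderiv_fderiv_apply_eq_of_contDiffAt {f : E3 → ℝ} {y : E3} (hf : ContDiffAt ℝ 2 f y)
    (v w : E3) :
    fderiv ℝ (fun z ↦ fderiv ℝ f z v) y w = fderiv ℝ (fderiv ℝ f) y w v := by
  have hf2 : DifferentiableAt ℝ (fderiv ℝ f) y :=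
    (hf.fderiv_right (m := 1) le_rfl).differentiableAt one_ne_zero
  have h : HasFDerivAt (fun z ↦ fderiv ℝ f z v) ((fderiv ℝ (fderiv ℝ f) y).flip v) y := by
    have := hf2.hasFDerivAt.clm_apply (hasFDerivAt_const v y)
    simpa using this
  rw [h.fderiv, ContinuousLinearMap.flip_apply]

/-- An `L²(Ω)` bound from a pointwise square bound: if `‖g‖² ≤ c² G` on `Ω` then
`‖g‖_{L²(Ω)} ≤ c (∫_Ω G)^{1/2}`. [folklore] -/
theorem eLpNorm_two_restrict_le_of_sq_le {Ω : Set E3} (hΩ : MeasurableSet Ω) {g : E3 → ℝ}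
    {G : E3 → ℝ≥0∞} {c : ℝ≥0∞} (hc : c ≠ ⊤) (h : ∀ y ∈ Ω, ‖g y‖ₑ ^ 2 ≤ c ^ 2 * G y) :
    eLpNorm g 2 (volume.restrict Ω) ≤ c * (∫⁻ y in Ω, G y) ^ (1 / 2 : ℝ) := by
  rw [eLpNorm_eq_lintegral_rpow_enorm_toReal two_ne_zero ENNReal.ofNat_ne_top, ENNReal.toReal_ofNat]
  have h1 : ∫⁻ y in Ω, ‖g y‖ₑ ^ (2 : ℝ) ≤ c ^ 2 * ∫⁻ y in Ω, G y := by
    rw [← lintegral_const_mul' _ _ (ENNReal.pow_ne_top hc)]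
    refine setLIntegral_mono' hΩ fun y hy => ?_
    rw [ENNReal.rpow_two]
    exact h y hy
  calc (∫⁻ y in Ω, ‖g y‖ₑ ^ (2 : ℝ)) ^ (1 / (2 : ℝ))
      ≤ (c ^ 2 * ∫⁻ y in Ω, G y) ^ (1 / (2 : ℝ)) := ENNReal.rpow_le_rpow h1 (by norm_num)
    _ = c * (∫⁻ y in Ω, G y) ^ (1 / 2 : ℝ) := by
        rw [ENNReal.mul_rpow_of_nonneg _ _ (by norm_num : (0 : ℝ) ≤ 1 / 2)]
        congr 1
        rw [← ENNReal.rpow_natCast, ← ENNReal.rpow_mul]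
        norm_num

/-- Pointwise: `‖f(y)‖² ≤ f(y)² + ‖Df(y)‖² + ‖D²f(y)‖²` (in `ℝ≥0∞`). [folklore] -/
theorem enorm_sq_le_localH2_integrand (f : E3 → ℝ) (y : E3) :
    ‖f y‖ₑ ^ 2 ≤ (1 : ℝ≥0∞) ^ 2 *
      ENNReal.ofReal (f y ^ 2 + ‖fderiv ℝ f y‖ ^ 2 + ‖fderiv ℝ (fderiv ℝ f) y‖ ^ 2) := by
  rw [one_pow, one_mul, Real.enorm_eq_ofReal_abs, ← ENNReal.ofReal_pow (abs_nonneg _), sq_abs]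
  exact ENNReal.ofReal_le_ofReal
    (by linarith [sq_nonneg ‖fderiv ℝ f y‖, sq_nonneg ‖fderiv ℝ (fderiv ℝ f) y‖])

/-- Pointwise: `‖Df(y) v‖² ≤ ‖v‖² (f(y)² + ‖Df(y)‖² + ‖D²f(y)‖²)` (in `ℝ≥0∞`). [folklore] -/
theorem enorm_sq_fderiv_apply_le_localH2_integrand (f : E3 → ℝ) (v y : E3) :
    ‖fderiv ℝ f y v‖ₑ ^ 2 ≤ ‖v‖ₑ ^ 2 *
      ENNReal.ofReal (f y ^ 2 + ‖fderiv ℝ f y‖ ^ 2 + ‖fderiv ℝ (fderiv ℝ f) y‖ ^ 2) := by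
  have h1 : |fderiv ℝ f y v| ≤ ‖fderiv ℝ f y‖ * ‖v‖ := by
    rw [← Real.norm_eq_abs]; exact ContinuousLinearMap.le_opNorm _ _
  have h3 : (fderiv ℝ f y v) ^ 2 ≤ (‖fderiv ℝ f y‖ * ‖v‖) ^ 2 := by
    rw [← sq_abs]; exact pow_le_pow_left₀ (abs_nonneg _) h1 2
  have h2 : (fderiv ℝ f y v) ^ 2 ≤
      ‖v‖ ^ 2 * (f y ^ 2 + ‖fderiv ℝ f y‖ ^ 2 + ‖fderiv ℝ (fderiv ℝ f) y‖ ^ 2) := by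
    rw [mul_pow] at h3
    linarith [mul_nonneg (sq_nonneg ‖v‖) (sq_nonneg (f y)),
      mul_nonneg (sq_nonneg ‖v‖) (sq_nonneg ‖fderiv ℝ (fderiv ℝ f) y‖)]
  rw [Real.enorm_eq_ofReal_abs, ← ENNReal.ofReal_pow (abs_nonneg _), sq_abs, ← ofReal_norm,
    ← ENNReal.ofReal_pow (norm_nonneg _), ← ENNReal.ofReal_mul (sq_nonneg _)]
  exact ENNReal.ofReal_le_ofReal h2

/-- Pointwise, for `f` of class `C²` at `y`:
`‖∂_w ∂_v f(y)‖² ≤ (‖w‖ ‖v‖)² (f(y)² + ‖Df(y)‖² + ‖D²f(y)‖²)` (in `ℝ≥0∞`). [folklore] -/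
theorem enorm_sq_fderiv_fderiv_apply_le_localH2_integrand {f : E3 → ℝ} {y : E3}
    (hf : ContDiffAt ℝ 2 f y) (v w : E3) :
    ‖fderiv ℝ (fun z ↦ fderiv ℝ f z v) y w‖ₑ ^ 2 ≤ (‖w‖ₑ * ‖v‖ₑ) ^ 2 *
      ENNReal.ofReal (f y ^ 2 + ‖fderiv ℝ f y‖ ^ 2 + ‖fderiv ℝ (fderiv ℝ f) y‖ ^ 2) := by
  rw [fderiv_fderiv_apply_eq_of_contDiffAt hf]
  have h1 : |fderiv ℝ (fderiv ℝ f) y w v| ≤ ‖fderiv ℝ (fderiv ℝ f) y‖ * ‖w‖ * ‖v‖ := by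
    rw [← Real.norm_eq_abs]
    exact (ContinuousLinearMap.le_opNorm _ _).trans
      (mul_le_mul_of_nonneg_right (ContinuousLinearMap.le_opNorm _ _) (norm_nonneg _))
  have h3 : (fderiv ℝ (fderiv ℝ f) y w v) ^ 2 ≤ (‖fderiv ℝ (fderiv ℝ f) y‖ * ‖w‖ * ‖v‖) ^ 2 := by
    rw [← sq_abs]; exact pow_le_pow_left₀ (abs_nonneg _) h1 2
  have h2 : (fderiv ℝ (fderiv ℝ f) y w v) ^ 2 ≤
      (‖w‖ * ‖v‖) ^ 2 * (f y ^ 2 + ‖fderiv ℝ f y‖ ^ 2 + ‖fderiv ℝ (fderiv ℝ f) y‖ ^ 2) := by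
    rw [mul_pow, mul_pow] at h3
    rw [mul_pow]
    linarith [mul_nonneg (mul_nonneg (sq_nonneg ‖w‖) (sq_nonneg ‖v‖)) (sq_nonneg (f y)),
      mul_nonneg (mul_nonneg (sq_nonneg ‖w‖) (sq_nonneg ‖v‖)) (sq_nonneg ‖fderiv ℝ f y‖)]
  rw [Real.enorm_eq_ofReal_abs, ← ENNReal.ofReal_pow (abs_nonneg _), sq_abs, ← ofReal_norm,
    ← ofReal_norm, ← ENNReal.ofReal_mul (norm_nonneg _),
    ← ENNReal.ofReal_pow (mul_nonneg (norm_nonneg _) (norm_nonneg _)),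
    ← ENNReal.ofReal_mul (sq_nonneg _)]
  exact ENNReal.ofReal_le_ofReal h2

/-- **The `W^{2,2}(Ω)` norm of a function smooth on `Ω` is controlled by its local `H²`
energy**: there is a constant `C < ∞` (depending only on the basis `Module.finBasis ℝ E3` used in
the sum-form norm `eSobolevDomainNorm`) such that for every open `Ω ⊆ E3` and every `f` of class
`C^∞` on `Ω`, `‖f‖_{W^{2,2}(Ω)} ≤ C (∫_Ω f² + ‖Df‖² + ‖D²f‖²)^{1/2}`: the infima in the norm are
bounded by their values at the classical derivatives (`MeyersSerrin.hasWeakFDerivOn_of_contDiffOn`,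
`SobolevApprox.eSobolevDomainNorm_succ_le`), whose components `∂ᵢ f = Df eᵢ`,
`∂ⱼ ∂ᵢ f = D²f eⱼ eᵢ` are bounded pointwise by `‖eᵢ‖ ‖Df‖`, `‖eⱼ‖ ‖eᵢ‖ ‖D²f‖` (Adams, *Sobolev
Spaces* (1975), ¶3.1, the inclusion `C²(Ω) ∩ {‖·‖_{2,2} < ∞} ⊂ W^{2,2}(Ω)`). [folklore] -/
theorem exists_eSobolevDomainNorm_two_le_localH2Energy :
    ∃ C : ℝ≥0∞, C < ⊤ ∧ ∀ (Ω : Opens E3) (f : E3 → ℝ), ContDiffOn ℝ ∞ f Ω →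
      eSobolevDomainNorm 2 2 Ω volume f ≤ C * localH2Energy Ω f ^ (1 / 2 : ℝ) := by
  set b := Module.finBasis ℝ E3 with hb
  refine ⟨1 + ∑ i, ‖b i‖ₑ + ∑ i, ∑ j, ‖b j‖ₑ * ‖b i‖ₑ, ?_, fun Ω f hf => ?_⟩
  · refine ENNReal.add_lt_top.2 ⟨ENNReal.add_lt_top.2 ⟨ENNReal.one_lt_top, ?_⟩, ?_⟩
    · exact ENNReal.sum_lt_top.2 fun i _ => enorm_lt_top
    · exact ENNReal.sum_lt_top.2 fun i _ => ENNReal.sum_lt_top.2 fun j _ =>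
        ENNReal.mul_lt_top enorm_lt_top enorm_lt_top
  set G : E3 → ℝ≥0∞ := fun y =>
    ENNReal.ofReal (f y ^ 2 + ‖fderiv ℝ f y‖ ^ 2 + ‖fderiv ℝ (fderiv ℝ f) y‖ ^ 2) with hG
  set S : ℝ≥0∞ := (∫⁻ y in (Ω : Set E3), G y) ^ (1 / 2 : ℝ) with hS
  have hS' : localH2Energy Ω f ^ (1 / 2 : ℝ) = S := rfl
  rw [hS']
  have hΩ : MeasurableSet (Ω : Set E3) := Ω.isOpen.measurableSet
  have hf2 : ∀ y ∈ (Ω : Set E3), ContDiffAt ℝ 2 f y := fun y hy => by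
    have h := contDiffAt_infty.1 (hf.contDiffAt (Ω.isOpen.mem_nhds hy)) 2
    exact_mod_cast h
  -- the classical derivatives are weak derivatives on `Ω`
  have hw0 : HasWeakFDerivOn Ω volume f (fderiv ℝ f) := MeyersSerrin.hasWeakFDerivOn_of_contDiffOn hf
  have hwi : ∀ i, HasWeakFDerivOn Ω volume (fun y => fderiv ℝ f y (b i))
      (fderiv ℝ fun y => fderiv ℝ f y (b i)) := fun i =>
    MeyersSerrin.hasWeakFDerivOn_of_contDiffOn (MeyersSerrin.contDiffOn_fderiv_apply hf (b i))
  -- the three `L²` bounds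
  have hL0 : eLpNorm f 2 (volume.restrict Ω) ≤ 1 * S :=
    eLpNorm_two_restrict_le_of_sq_le hΩ ENNReal.one_ne_top fun y _ =>
      enorm_sq_le_localH2_integrand f y
  have hL1 : ∀ i, eLpNorm (fun y => fderiv ℝ f y (b i)) 2 (volume.restrict Ω) ≤ ‖b i‖ₑ * S :=
    fun i => eLpNorm_two_restrict_le_of_sq_le hΩ enorm_ne_top fun y _ =>
      enorm_sq_fderiv_apply_le_localH2_integrand f (b i) y
  have hL2 : ∀ i j, eLpNorm (fun y => fderiv ℝ (fun z => fderiv ℝ f z (b i)) y (b j)) 2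
      (volume.restrict Ω) ≤ (‖b j‖ₑ * ‖b i‖ₑ) * S :=
    fun i j => eLpNorm_two_restrict_le_of_sq_le hΩ
      (ENNReal.mul_ne_top enorm_ne_top enorm_ne_top) fun y hy =>
        enorm_sq_fderiv_fderiv_apply_le_localH2_integrand (hf2 y hy) (b i) (b j)
  -- first and second level of the sum-form norm, with the classical witnesses
  have hlev1 : ∀ i, eSobolevDomainNorm 1 2 Ω volume (fun y => fderiv ℝ f y (b i)) ≤
      ‖b i‖ₑ * S + ∑ j, (‖b j‖ₑ * ‖b i‖ₑ) * S := by
    intro i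
    refine (SobolevApprox.eSobolevDomainNorm_succ_le (hwi i)).trans ?_
    simp only [eSobolevDomainNorm_zero]
    exact add_le_add (hL1 i) (Finset.sum_le_sum fun j _ => hL2 i j)
  calc eSobolevDomainNorm 2 2 Ω volume f
      ≤ eLpNorm f 2 (volume.restrict Ω) +
          ∑ i, eSobolevDomainNorm 1 2 Ω volume (fun y => fderiv ℝ f y (b i)) :=
        SobolevApprox.eSobolevDomainNorm_succ_le hw0
    _ ≤ 1 * S + ∑ i, (‖b i‖ₑ * S + ∑ j, (‖b j‖ₑ * ‖b i‖ₑ) * S) :=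
        add_le_add hL0 (Finset.sum_le_sum fun i _ => hlev1 i)
    _ = (1 + ∑ i, ‖b i‖ₑ + ∑ i, ∑ j, ‖b j‖ₑ * ‖b i‖ₑ) * S := by
        rw [Finset.sum_add_distrib, add_mul, add_mul, Finset.sum_mul, Finset.sum_mul, add_assoc]
        congr 2
        exact Finset.sum_congr rfl fun i _ => (Finset.sum_mul _ _ _).symm

end SobolevBound

/-! ### The higher-order local energy of the gradient components and the assembly -/

namespace Kerr

/-- The **slice gradient components** of a function `ψ` on the exterior chart along the
Kerr–Schild slice `{t* = τ}`: `G_μ(y) = ∂_μ ψ̃(τ, y)`, `μ = 0, …, 3` (`ψ̃` the extension of `ψ` by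
zero, `∂_μ = D(·)(e_μ)` the coordinate partial derivatives of `WeightedNorms.coordEnergyDensity`,
so that `∑_μ G_μ(y)² = coordEnergyDensity ψ (τ, y)`, `coordEnergyDensity_ofTimeSpace`); as
functions of `y ∈ E3` these are `n_Σ ψ`, `∇_Σ ψ` of DRSR (31) up to the frame change of
`KerrDerivativeDecay.lean`. DRSR arXiv:1402.7034, §3.3. [folklore] -/
def sliceGradComp (M a : ℝ) (ψ : region a (rPlus M a) → ℝ) (τ : ℝ) (μ : Fin 4) : E3 → ℝ :=
  fun y ↦ fderiv ℝ (Function.extend Subtype.val ψ 0) (E4.ofTimeSpace τ y)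
    (EuclideanSpace.single μ (1 : ℝ))

/-- The coordinate energy density at a slice point is the sum of the squares of the slice
gradient components. [folklore] -/
theorem coordEnergyDensity_ofTimeSpace (M a : ℝ) (ψ : region a (rPlus M a) → ℝ) (τ : ℝ) (y : E3) :
    coordEnergyDensity (region a (rPlus M a)) ψ (E4.ofTimeSpace τ y) =
      ∑ μ, sliceGradComp M a ψ τ μ y ^ 2 := rfl

/-- The slice gradient components of a smooth `ψ` are smooth on the exterior slice
`S = {r(0, ·) > r₊}` (composition of a partial derivative of the smooth extension with the affine
map `y ↦ (τ, y)`). [folklore] -/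
theorem contDiffOn_sliceGradComp {M a : ℝ} {ψ : region a (rPlus M a) → ℝ}
    (hψ : ContMDiff 𝓘(ℝ, E4) 𝓘(ℝ, ℝ) ∞ ψ) (τ : ℝ) (μ : Fin 4) :
    ContDiffOn ℝ ∞ (sliceGradComp M a ψ τ μ) (slice a (rPlus M a) : Set E3) := by
  intro y hy
  have hx : E4.ofTimeSpace τ y ∈ region a (rPlus M a) := ofTimeSpace_mem_region_iff.2 hy
  have h1 : ContDiffAt ℝ ∞ (fun x ↦ fderiv ℝ (Function.extend Subtype.val ψ 0) x
      (EuclideanSpace.single μ (1 : ℝ))) (E4.ofTimeSpace τ y) :=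
    contDiffAt_fderiv_apply_const_infty (contDiffAt_extend hψ ⟨_, hx⟩) _
  exact (h1.comp y (E4.contDiff_ofTimeSpace τ).contDiffAt).contDiffWithinAt

/-- The **higher-order local energy of the gradient** through the slice portion
`{t* = τ} ∩ {r > r₊} ∩ {‖y‖ < R}`:
`𝓔(τ, R) = ∑_μ ∫_{r₊ < r(0,y), ‖y‖ < R} (G_μ² + ‖D G_μ‖² + ‖D² G_μ‖²) dy`, `G_μ(y) = ∂_μ ψ̃(τ, y)`,
i.e. the sum over `μ` of the squares of the (classical) `H²`-norms of the components of the
spacetime gradient over the slice ball — all coordinate derivatives `∂_y^β ∂_μ ψ`, `|β| ≤ 2`, of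
orders one to three with at most one transversal index. This is the Cartesian form, on the
compact portions `{r ≤ R}` where the hyperboloidal leaves `Σ̃_τ(h♯_{R₁})` are the Kerr–Schild
slices, of the non-degenerate higher-order energies `∑_{1≤i≤3} ‖ψ‖²_{H̊ⁱ(Σ_τ ∩ {r ≤ R})} +
‖n_Σ ψ‖²_{H̊^{i−1}}` of DRSR Thm. 3.2 (29) / the near part
`∑_{j ≤ 1} ∑_{j₁+j₂ ≤ 2+j} ∫_{{t̄=τ} ∩ {r ≤ R₁}} |∇^{j₁}_{h_{τ,N}} N^{j₂} φ|² dh_N` of Moschidis'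
`𝓔_bound^{(ε,2,1)}[φ](τ)` (arXiv:1509.08489, §9.2). `ℝ≥0∞`-valued. [cite: Moschidis2016, §9.2] -/
def localGradSobolevEnergy (M a : ℝ) (ψ : region a (rPlus M a) → ℝ) (τ R : ℝ) : ℝ≥0∞ :=
  ∑ μ : Fin 4, localH2Energy ((slice a (rPlus M a) : Set E3) ∩ ball 0 R) (sliceGradComp M a ψ τ μ)

/-- The higher-order local energy of the gradient is monotone in the radius (so that a decay
estimate for all large radii gives one for every radius). [folklore] -/
theorem localGradSobolevEnergy_mono (M a : ℝ) (ψ : region a (rPlus M a) → ℝ) (τ : ℝ) {R R' : ℝ}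
    (h : R ≤ R') : localGradSobolevEnergy M a ψ τ R ≤ localGradSobolevEnergy M a ψ τ R' :=
  Finset.sum_le_sum fun μ _ =>
    localH2Energy_mono (inter_subset_inter_right _ (ball_subset_ball h)) (sliceGradComp M a ψ τ μ)

/-- **DRSR Corollary 3.1 (31), coordinate form, from the higher-order local energy decay and
Sobolev's inequality on the slice portions.** **Hypothesis (H)** (the energy-level input, *not* a
named fact — D-0026; a literature seat for Moschidis 2016 may vendor it verbatim): for `|a| < M`,
every admissible wave `ψ`, every `δ > 0` and every coordinate radius `R` admit `C` with
`localGradSobolevEnergy M a ψ τ R ≤ C τ^{-4+2δ}` for `τ ≥ 1`. *Derivation from print.* Moschidis,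
arXiv:1509.08489, Thm. 9.1 with `d = 3`, `q = 2`, `m = 1`, `F = 0`:
`𝓔_en^{(0,2,1)}[φ](τ) + 𝓔_bound^{(ε,2,1)}[φ](τ) + … ≲_{ε} τ^{-4+C₁ε} 𝓔_bound^{(4,2,1+…)}[φ](0)`,
whose left-hand side contains (§9.2) `∑_{j≤1} ∑_{0≤j₁+j₂≤2+j} ∫_{{t̄=τ}∩{r≤R₁}}
|∇^{j₁}_{h_{τ,N}} N^{j₂}φ|²_{h_{τ,N}} dh_N`, i.e. all derivatives of `φ` of orders `≤ 3` on the
compact portion of the leaf, applicable to subextremal Kerr by his §1.3.3 ("(M_{a,M}, g_{a,M})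
satisfies all the geometric assumptions … by applying Theorems 8.1 and 9.1 one can readily upgrade
[DRSR's Thms. 3.1–3.2] to … Corollary 3.1", printed there with
`∫_{Σ̃_τ} J^N(Nφ) n ≤ C E τ^{-4+δ}` and `sup_{Σ̃_τ} |Nφ| + |∇_Σ̃ φ| ≤ C √E τ⁻²`); on Kerr this is the
second estimate of DRSR Cor. 3.1, `∫_{Σ̃_τ∩{r≤R}} J^N[Nψ] n ≤ C(a₀,M,δ,R) E τ^{-4+2δ}`, together with
its commuted versions and the elliptic estimate (29) of Thm. 3.2 transferred to `Σ̃_τ` (§3.3), and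
at first order the square-integrated (31). The Cartesian rendering ((a)–(d) of the module docstring
of `KerrPointwiseDecayHierarchy.lean`: on `{r ≤ R₁}` the leaves `Σ̃_τ(h♯_{R₁})` are the slices
`{t* = τ}`, `h_{τ,N} ≃ δ`, `dh_N ≃ dy`, `N`, `∂_{t*}` and `e₀` differ by smooth `φ_τ`-invariant frames,
covariant and coordinate derivatives by lower-order terms with bounded coefficients) costs constants
`C(M, a, R₁)`; the data of an admissible wave induce smooth compactly supported data on
`Σ̃₀(h♯_{R₁})` for `R₁ ≥ max(R₀, R, ρ)` (`KerrWaveDecay.lean`, (i)–(ii)), so `𝓔_bound(0) < ∞`;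
the loss `C₁ε` is renamed `2δ`. Hypothesis (H) asserts less than the sources (existential
`ψ`-dependent constants, compact portions only). **Conclusion**:
`Literature.Geometry.Lorentzian.drsr_wave_derivative_decay_kerr` (`KerrWaveDecay.lean`).
**Proof** (the Sobolev step of DRSR p. 14 / arXiv:0910.4957 §5, carried out): fix `ψ, δ, R` and
`R' = max(R, 2M) + 1`; the slice ball `Ω = {r₊ < r(0,·)} ∩ {‖y‖ < R'}` is a bounded Lipschitz domain
(`isLipschitzDomain_sliceBall`), so `‖G(y)‖ ≤ K ‖G‖_{W^{2,2}(Ω)}` on `Ω`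
(`exists_enorm_le_eSobolevDomainNorm_sliceBall`); each gradient component `G_μ = ∂_μψ̃(τ, ·)` is
smooth on `Ω` with `‖G_μ‖_{W^{2,2}(Ω)} ≤ C_b 𝓔(τ, R')^{1/2}`
(`exists_eSobolevDomainNorm_two_le_localH2Energy`), finite by (H), hence `G_μ ∈ W^{2,2}(Ω)`
(`eSobolevDomainNorm_lt_top_iff_holds`); so `G_μ(y)² ≤ (K C_b)² C τ^{-4+2δ}` and
`∑_μ G_μ(y)² ≤ 4 (K C_b)² C τ^{-4+2δ}` at every slice point with `‖y‖ ≤ R`. [cite: DafermosRodnianskiShlapentokhrothman2014, Cor. 3.1 (31) with p. 14; Moschidis2016 Thm. 9.1, §9.2, §1.3.3] -/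
theorem _root_.Literature.Geometry.Lorentzian.drsr_wave_derivative_decay_kerr_of_localGradSobolevEnergy_decay
    (hH : ∀ [Facts] [SliceFacts] (M a : ℝ), IsSubextremal M a →
      ∀ ψ : region a (rPlus M a) → ℝ, Literature.Geometry.Lorentzian.IsAdmissibleKerrWave M a ψ →
        ∀ δ : ℝ, 0 < δ → ∀ R : ℝ, ∃ C : ℝ, ∀ τ : ℝ, 1 ≤ τ →
          localGradSobolevEnergy M a ψ τ R ≤ ENNReal.ofReal (C * τ ^ (-4 + 2 * δ))) :
    drsr_wave_derivative_decay_kerr := by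
  intro _ _ M a hMa ψ hψ δ hδ R
  -- a slice ball containing `{‖y‖ ≤ R}` on which Sobolev's inequality is available
  set R' : ℝ := max R (2 * M) + 1 with hR'
  have hR'M : 2 * M < R' := (le_max_right _ _).trans_lt (lt_add_one _)
  have hRR' : R < R' := (le_max_left _ _).trans_lt (lt_add_one _)
  obtain ⟨K, hK, hSob⟩ := exists_enorm_le_eSobolevDomainNorm_sliceBall hMa hR'M
  obtain ⟨Cb, hCb, hW⟩ := exists_eSobolevDomainNorm_two_le_localH2Energy
  obtain ⟨C, hC⟩ := hH M a hMa ψ hψ δ hδ R'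
  set C₀ : ℝ := max C 0 with hC₀
  have hKCb : K * Cb ≠ ⊤ := ENNReal.mul_ne_top hK.ne hCb.ne
  refine ⟨4 * ((K * Cb).toReal ^ 2 * C₀), fun τ hτ y hy hyR ↦ ?_⟩
  have hτ0 : 0 ≤ τ := zero_le_one.trans hτ
  have hp : 0 ≤ C₀ * τ ^ (-4 + 2 * δ) := mul_nonneg (le_max_right _ _) (Real.rpow_nonneg hτ0 _)
  have hyS : y ∈ slice a (rPlus M a) := ofTimeSpace_mem_region_iff.1 hy
  have hyΩ : y ∈ sliceBall M a R' := mem_sliceBall_iff.2 ⟨hyS, hyR.trans_lt hRR'⟩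
  -- the energy bound at time `τ`
  have hE : localGradSobolevEnergy M a ψ τ R' ≤ ENNReal.ofReal (C₀ * τ ^ (-4 + 2 * δ)) :=
    (hC τ hτ).trans (ENNReal.ofReal_le_ofReal
      (mul_le_mul_of_nonneg_right (le_max_left _ _) (Real.rpow_nonneg hτ0 _)))
  -- each gradient component at `y`
  have hcomp : ∀ μ : Fin 4,
      sliceGradComp M a ψ τ μ y ^ 2 ≤ (K * Cb).toReal ^ 2 * C₀ * τ ^ (-4 + 2 * δ) := by
    intro μ
    set g := sliceGradComp M a ψ τ μ with hg
    have hgs : ContDiffOn ℝ ∞ g (sliceBall M a R' : Set E3) :=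
      (contDiffOn_sliceGradComp hψ.1 τ μ).mono (by rw [coe_sliceBall]; exact inter_subset_left)
    have hgc : ContinuousOn g (sliceBall M a R' : Set E3) := hgs.continuousOn
    have hI : localH2Energy (sliceBall M a R' : Set E3) g ≤ ENNReal.ofReal (C₀ * τ ^ (-4 + 2 * δ)) := by
      refine le_trans ?_ hE
      rw [localGradSobolevEnergy, coe_sliceBall]
      exact Finset.single_le_sum (f := fun ν => localH2Energy _ (sliceGradComp M a ψ τ ν))
        (fun _ _ => zero_le) (Finset.mem_univ μ)
    have hnorm : Literature.Analysis.FunctionSpaces.eSobolevDomainNorm 2 2 (sliceBall M a R')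
        volume g ≤ Cb * (ENNReal.ofReal (C₀ * τ ^ (-4 + 2 * δ))) ^ (1 / 2 : ℝ) :=
      (hW _ g hgs).trans (mul_le_mul_right (ENNReal.rpow_le_rpow hI (by norm_num)) _)
    have hfin : Literature.Analysis.FunctionSpaces.eSobolevDomainNorm 2 2 (sliceBall M a R')
        volume g < ⊤ :=
      hnorm.trans_lt (ENNReal.mul_lt_top hCb
        (ENNReal.rpow_lt_top_of_nonneg (by norm_num) ENNReal.ofReal_ne_top))
    have hmem : Literature.Analysis.FunctionSpaces.MemSobolevDomain 2 2 (sliceBall M a R')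
        volume g :=
      (Literature.Analysis.FunctionSpaces.eSobolevDomainNorm_lt_top_iff_holds
        (hgc.aestronglyMeasurable (sliceBall M a R').isOpen.measurableSet)).1 hfin
    have hpt := hSob g hmem hgc y hyΩ
    -- back to real numbers
    have h1 : ‖g y‖ₑ ≤ K * Cb * ENNReal.ofReal (Real.sqrt (C₀ * τ ^ (-4 + 2 * δ))) := by
      calc ‖g y‖ₑ ≤ K * Literature.Analysis.FunctionSpaces.eSobolevDomainNorm 2 2
            (sliceBall M a R') volume g := hpt
        _ ≤ K * (Cb * (ENNReal.ofReal (C₀ * τ ^ (-4 + 2 * δ))) ^ (1 / 2 : ℝ)) :=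
            mul_le_mul_right hnorm K
        _ = K * Cb * ENNReal.ofReal (Real.sqrt (C₀ * τ ^ (-4 + 2 * δ))) := by
            rw [mul_assoc, Real.sqrt_eq_rpow, ENNReal.ofReal_rpow_of_nonneg hp (by norm_num)]
    have h2 : |g y| ≤ (K * Cb).toReal * Real.sqrt (C₀ * τ ^ (-4 + 2 * δ)) := by
      have := ENNReal.toReal_mono (ENNReal.mul_ne_top hKCb ENNReal.ofReal_ne_top) h1
      rwa [Real.enorm_eq_ofReal_abs, ENNReal.toReal_ofReal (abs_nonneg _), ENNReal.toReal_mul,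
        ENNReal.toReal_ofReal (Real.sqrt_nonneg _)] at this
    calc g y ^ 2 = |g y| ^ 2 := (sq_abs _).symm
      _ ≤ ((K * Cb).toReal * Real.sqrt (C₀ * τ ^ (-4 + 2 * δ))) ^ 2 :=
          pow_le_pow_left₀ (abs_nonneg _) h2 2
      _ = (K * Cb).toReal ^ 2 * C₀ * τ ^ (-4 + 2 * δ) := by
          rw [mul_pow, Real.sq_sqrt hp]; ring
  -- sum over the four components
  calc coordEnergyDensity (exterior M a) ψ (E4.ofTimeSpace τ y)
      = ∑ μ, sliceGradComp M a ψ τ μ y ^ 2 := coordEnergyDensity_ofTimeSpace M a ψ τ y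
    _ ≤ ∑ _μ : Fin 4, (K * Cb).toReal ^ 2 * C₀ * τ ^ (-4 + 2 * δ) :=
        Finset.sum_le_sum fun μ _ => hcomp μ
    _ = 4 * ((K * Cb).toReal ^ 2 * C₀) * τ ^ (-4 + 2 * δ) := by
        rw [Finset.sum_const, Finset.card_univ, Fintype.card_fin, nsmul_eq_mul]
        push_cast
        ring


/-- Corollary of the assembly: under hypothesis (E) the local coordinate energy of
`BlackHoles.lean` decays like `τ⁻²` (`Literature.Geometry.Lorentzian.drsr_wave_polynomial_decay_kerr`,
via `drsr_wave_polynomial_decay_kerr_of_derivative_decay` of `KerrWaveDecay.lean`: integrate the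
pointwise bound with `δ = 1` over the coordinate ball). DRSR arXiv:1402.7034, Cor. 3.1. [cite: DafermosRodnianskiShlapentokhrothman2014, Cor. 3.1 (31)] -/
theorem _root_.Literature.Geometry.Lorentzian.drsr_wave_polynomial_decay_kerr_of_localGradSobolevEnergy_decay
    (hH : ∀ [Facts] [SliceFacts] (M a : ℝ), IsSubextremal M a →
      ∀ ψ : region a (rPlus M a) → ℝ, Literature.Geometry.Lorentzian.IsAdmissibleKerrWave M a ψ →
        ∀ δ : ℝ, 0 < δ → ∀ R : ℝ, ∃ C : ℝ, ∀ τ : ℝ, 1 ≤ τ →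
          localGradSobolevEnergy M a ψ τ R ≤ ENNReal.ofReal (C * τ ^ (-4 + 2 * δ))) :
    drsr_wave_polynomial_decay_kerr :=
  drsr_wave_polynomial_decay_kerr_of_derivative_decay
    (drsr_wave_derivative_decay_kerr_of_localGradSobolevEnergy_decay hH)

/-- Corollary of the assembly: under hypothesis (E) the local energy of admissible waves tends to
`0` (`Literature.Geometry.Lorentzian.drsr_wave_local_energy_decay_kerr` of `BlackHoles.lean`, via
`drsr_wave_local_energy_decay_kerr_of_derivative_decay` of `KerrWaveDecay.lean`). DRSR
arXiv:1402.7034, Cor. 3.1. [cite: DafermosRodnianskiShlapentokhrothman2014, Cor. 3.1 (31)] -/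
theorem _root_.Literature.Geometry.Lorentzian.drsr_wave_local_energy_decay_kerr_of_localGradSobolevEnergy_decay
    (hH : ∀ [Facts] [SliceFacts] (M a : ℝ), IsSubextremal M a →
      ∀ ψ : region a (rPlus M a) → ℝ, Literature.Geometry.Lorentzian.IsAdmissibleKerrWave M a ψ →
        ∀ δ : ℝ, 0 < δ → ∀ R : ℝ, ∃ C : ℝ, ∀ τ : ℝ, 1 ≤ τ →
          localGradSobolevEnergy M a ψ τ R ≤ ENNReal.ofReal (C * τ ^ (-4 + 2 * δ))) :
    drsr_wave_local_energy_decay_kerr :=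
  drsr_wave_local_energy_decay_kerr_of_derivative_decay
    (drsr_wave_derivative_decay_kerr_of_localGradSobolevEnergy_decay hH)

end Kerr

end Literature.Geometry.Lorentzian

end
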